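import Literature.AnabelianGeometry.EtaleTheta.GalSectSplittingsTransport
import Literature.AnabelianGeometry.EtaleTheta.GalSectTorsorTrivialisation
import HarnessLib

/-!
# Equivariance of `μ`-sub-structures is NOT automatic — a kernel certificate at the abstract
# [GalSect] Def. 4.1 carrier (Klein four-group pair, shear automorphism) (proof-only)

Mochizuki, *Galois sections in absolute anabelian geometry* [GalSect], Nagoya Math. J. **179** (2005), §4 /
Def. 4.1 [cite: MochizukiGalSect2005, Def 4.1 p.33]; *The étale theta function …* [EtTh], Publ. RIMS **45**
(2009), Cor. 2.8 (ii) p.268 [cite: MochizukiEtTh2009, Cor 2.8 (ii) p.42].  abc-iut cell, layer L2, block C / W6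
row `EtTh:Cor2.8(ii)` (seat abc-iut-w6-d050 gen 4); companion of the binder census `GalSectCor28iiNodeCensus.lean`
(p459512) of the node closer `GalSectCor28iiNodeCloser.lean` (p441545).  PROOF-ONLY: no definitions, no
instances, no named facts — the countermodel lives inside `∃`-statements.

WHAT IS CERTIFIED.  ROW (B)'s typed Cor. 2.8 (ii) (`TemperedCoverData.Cor28iiAt`) asks, at each cusp, for a
`μ_n`-sub-structure `R` of the canonical integral structure that the class transport along every list-automorphism
carries onto the structure at the image cusp; the census (p459512) showed that the EXISTENCE of such sub-structures
is automatic under the v2 laws of `Cor28iiData` (`canonical_isStructure`, `mu_le`) and that the member statement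
is EXACTLY the existence of a weakly EQUIVARIANT family.  This file shows, in the kernel, that the equivariance is
NOT a consequence of those laws — it is the substantive named input (print: "the `{±1}`-structure of Theorem
1.10, (iii), determines … [cf. [GalSect] Cor. 4.12] … preserved by `γ`").  Over the abstract carrier of abc-iut-w5-d062's
ROW (B) (`GalSect.CuspPair`, `TorsorData`, `IsStructure`/`IsSubStructure`, `map`, class transport):

* `exists_klein_noInvariantSubStructure` — in the Klein four-group `Multiplicative (ZMod 2 × ZMod 2)` (discrete)
  the cuspidal pair `(D, I) = (⊤, ⟨(1,0)⟩)` has EXACTLY TWO splitting classes (`⟨(0,1)⟩`, `⟨(1,1)⟩`), hence a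
  genuine `ℤ/2`-torsor structure; its canonical structure `Rcan :=` the whole torsor IS a `⊤`-structure
  ("`O_K^× := (K^×)^∧`", so `μ := ⊥ ≤ O_K^×`); the shear `Γ : (a,b) ↦ (a+b,b)` is a topological automorphism
  with `P.map Γ = P`, every class transport `e` along `Γ` PRESERVES `Rcan` (`e '' Rcan = Rcan`) — and yet NO
  `μ`-sub-structure `R` of `Rcan` (a single class) satisfies `e '' R = R`: the shear swaps the two classes;
* `exists_klein_not_weaklyEquivariantFamily` — the same, in the shape of the census' weak equivariance: there is
  NO `μ`-sub-structure of the canonical structure carried onto itself by the class transports along `Γ`.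

So the v2 torsor laws + pair preservation + even preservation of the canonical integral structure do not pin a
`μ_n`-orbit; WHICH orbit, equivariantly, is exactly what Thm. 1.10 (iii) / the Kummer class of the theta roots must
supply (L2 census v1.4 item D6 / K2 (gen)).  The small lemmas `klein_*` classify the splittings of the Klein pair.

HONEST FRAMING: a certificate about OUR typed abstract carrier (consistency / independence evidence), not about any
tempered fundamental group; [GalSect], [EtTh] are refereed published papers and nothing printed is asserted or
denied here; typed ≠ proved; the abc-iut cell takes no side on [IUTchIII] Cor. 3.12, on which nothing here bears.
-/

noncomputable section

open scoped Pointwise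

namespace Literature.AnabelianGeometry.EtaleTheta.GalSect.CuspPair

/-- In the (commutative) Klein four-group every inner automorphism is trivial. [folklore] -/
private theorem klein_conj_eq_one (d : Multiplicative (ZMod 2 × ZMod 2)) : MulAut.conj d = 1 :=
  MulEquiv.ext fun x => by simp [MulAut.conj_apply, mul_inv_cancel_comm]

/-- Hence pointwise conjugation fixes every subgroup of the Klein four-group (so `I`-conjugacy of splittings is
equality and `(⊤, I)` is a cuspidal pair for every `I`). [folklore] -/
private theorem klein_conj_smul (d : Multiplicative (ZMod 2 × ZMod 2))
    (H : Subgroup (Multiplicative (ZMod 2 × ZMod 2))) : MulAut.conj d • H = H := by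
  rw [klein_conj_eq_one, one_smul]

/-- An element of the Klein four-group is `ofAdd` of its two coordinates. [folklore] -/
private theorem klein_eq_ofAdd (g : Multiplicative (ZMod 2 × ZMod 2)) :
    g = Multiplicative.ofAdd ((Multiplicative.toAdd g).1, (Multiplicative.toAdd g).2) := rfl

section Lemmas

variable {P : CuspPair (Multiplicative (ZMod 2 × ZMod 2))}

/-- For the Klein pair `(⊤, I)`, `I = {(·,0)}`: every splitting contains an element with second coordinate `1`
(it supplements `I`). [cite: MochizukiGalSect2005, §4 p.33] -/
theorem klein_exists_mem_snd_eq_one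
    (hI : ∀ g : Multiplicative (ZMod 2 × ZMod 2), g ∈ P.I ↔ (Multiplicative.toAdd g).2 = 0)
    (hD : P.D = ⊤) {S : Subgroup (Multiplicative (ZMod 2 × ZMod 2))}
    (hS : S ∈ P.splittings) : ∃ s ∈ S, (Multiplicative.toAdd s).2 = 1 := by
  obtain ⟨-, -, -, hsup⟩ := hS
  have hy : Multiplicative.ofAdd ((0 : ZMod 2), (1 : ZMod 2)) ∈ S ⊔ P.I := by
    rw [hsup, hD]; exact Subgroup.mem_top _
  obtain ⟨s, hs, i, hi, hsi⟩ := Subgroup.mem_sup.mp hy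
  refine ⟨s, hs, ?_⟩
  have hi0 : (Multiplicative.toAdd i).2 = 0 := (hI i).mp hi
  have h2 := congrArg (fun g => (Multiplicative.toAdd g).2) hsi
  simp only [toAdd_mul, Prod.snd_add, toAdd_ofAdd, hi0, add_zero] at h2
  exact h2

/-- For the Klein pair: the generator `(1,0)` of `I` lies in no splitting (`S ∩ I = 1`).
[cite: MochizukiGalSect2005, §4 p.33] -/
theorem klein_x_not_mem
    (hI : ∀ g : Multiplicative (ZMod 2 × ZMod 2), g ∈ P.I ↔ (Multiplicative.toAdd g).2 = 0)
    {S : Subgroup (Multiplicative (ZMod 2 × ZMod 2))}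
    (hS : S ∈ P.splittings) : Multiplicative.ofAdd ((1 : ZMod 2), (0 : ZMod 2)) ∉ S := by
  obtain ⟨-, -, hinf, -⟩ := hS
  intro hx
  have hxI : Multiplicative.ofAdd ((1 : ZMod 2), (0 : ZMod 2)) ∈ P.I := (hI _).mpr rfl
  have : Multiplicative.ofAdd ((1 : ZMod 2), (0 : ZMod 2)) ∈ S ⊓ P.I := ⟨hx, hxI⟩
  rw [hinf, Subgroup.mem_bot] at this
  exact absurd (congrArg (fun g => (Multiplicative.toAdd g).1) this) (by decide)

/-- For the Klein pair: a splitting contains `(0,1)` or `(1,1)` … [cite: MochizukiGalSect2005, §4 p.33] -/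
theorem klein_y_mem_or_z_mem
    (hI : ∀ g : Multiplicative (ZMod 2 × ZMod 2), g ∈ P.I ↔ (Multiplicative.toAdd g).2 = 0)
    (hD : P.D = ⊤) {S : Subgroup (Multiplicative (ZMod 2 × ZMod 2))} (hS : S ∈ P.splittings) :
    Multiplicative.ofAdd ((0 : ZMod 2), (1 : ZMod 2)) ∈ S ∨
      Multiplicative.ofAdd ((1 : ZMod 2), (1 : ZMod 2)) ∈ S := by
  obtain ⟨s, hs, h1⟩ := klein_exists_mem_snd_eq_one hI hD hS
  have key : ∀ v : ZMod 2 × ZMod 2, v.2 = 1 → v = (0, 1) ∨ v = (1, 1) := by decide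
  rcases key (Multiplicative.toAdd s) h1 with h | h
  · left; rw [klein_eq_ofAdd s, h] at hs; exact hs
  · right; rw [klein_eq_ofAdd s, h] at hs; exact hs

/-- … but not both (their product is the generator of `I`). [cite: MochizukiGalSect2005, §4 p.33] -/
theorem klein_not_y_and_z
    (hI : ∀ g : Multiplicative (ZMod 2 × ZMod 2), g ∈ P.I ↔ (Multiplicative.toAdd g).2 = 0)
    {S : Subgroup (Multiplicative (ZMod 2 × ZMod 2))} (hS : S ∈ P.splittings) :
    ¬ (Multiplicative.ofAdd ((0 : ZMod 2), (1 : ZMod 2)) ∈ S ∧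
      Multiplicative.ofAdd ((1 : ZMod 2), (1 : ZMod 2)) ∈ S) := by
  rintro ⟨hy, hz⟩
  have hx : Multiplicative.ofAdd ((0 : ZMod 2), (1 : ZMod 2)) *
      Multiplicative.ofAdd ((1 : ZMod 2), (1 : ZMod 2)) ∈ S := S.mul_mem hy hz
  have heq : Multiplicative.ofAdd ((0 : ZMod 2), (1 : ZMod 2)) *
      Multiplicative.ofAdd ((1 : ZMod 2), (1 : ZMod 2)) = Multiplicative.ofAdd ((1 : ZMod 2), (0 : ZMod 2)) := by
    decide
  rw [heq] at hx
  exact klein_x_not_mem hI hS hx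

/-- **Classification of the splittings of the Klein pair**: a splitting is determined by whether it contains
`(0,1)` — so the splittings are exactly `⟨(0,1)⟩` and `⟨(1,1)⟩`. [cite: MochizukiGalSect2005, §4 p.33] -/
theorem klein_splitting_eq_of_iff
    (hI : ∀ g : Multiplicative (ZMod 2 × ZMod 2), g ∈ P.I ↔ (Multiplicative.toAdd g).2 = 0)
    (hD : P.D = ⊤) {S T : Subgroup (Multiplicative (ZMod 2 × ZMod 2))} (hS : S ∈ P.splittings)
    (hT : T ∈ P.splittings)
    (h : Multiplicative.ofAdd ((0 : ZMod 2), (1 : ZMod 2)) ∈ S ↔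
      Multiplicative.ofAdd ((0 : ZMod 2), (1 : ZMod 2)) ∈ T) : S = T := by
  -- membership of each of the four elements is determined by membership of `(0,1)`
  have mem_iff : ∀ (U : Subgroup (Multiplicative (ZMod 2 × ZMod 2))), U ∈ P.splittings →
      ∀ g : Multiplicative (ZMod 2 × ZMod 2), g ∈ U ↔
        (g = 1 ∨ (g = Multiplicative.ofAdd ((0 : ZMod 2), (1 : ZMod 2)) ∧
            Multiplicative.ofAdd ((0 : ZMod 2), (1 : ZMod 2)) ∈ U) ∨
          (g = Multiplicative.ofAdd ((1 : ZMod 2), (1 : ZMod 2)) ∧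
            Multiplicative.ofAdd ((0 : ZMod 2), (1 : ZMod 2)) ∉ U)) := by
    intro U hU g
    have hx := klein_x_not_mem hI hU
    have hyz := klein_y_mem_or_z_mem hI hD hU
    have hnb := klein_not_y_and_z hI hU
    have cases4 : ∀ v : ZMod 2 × ZMod 2, v = (0, 0) ∨ v = (1, 0) ∨ v = (0, 1) ∨ v = (1, 1) := by decide
    rcases cases4 (Multiplicative.toAdd g) with hv | hv | hv | hv <;> rw [klein_eq_ofAdd g, hv]
    · -- `g = 1`
      exact iff_of_true U.one_mem (Or.inl rfl)
    · -- `g = (1,0) ∈ I`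
      refine iff_of_false hx ?_
      rintro (h1 | ⟨h1, -⟩ | ⟨h1, -⟩) <;> exact absurd h1 (by decide)
    · -- `g = (0,1)`
      constructor
      · exact fun hy => Or.inr (Or.inl ⟨rfl, hy⟩)
      · rintro (h1 | ⟨-, hy⟩ | ⟨h1, -⟩)
        · exact absurd h1 (by decide)
        · exact hy
        · exact absurd h1 (by decide)
    · -- `g = (1,1)`
      constructor
      · exact fun hz => Or.inr (Or.inr ⟨rfl, fun hy => hnb ⟨hy, hz⟩⟩)
      · rintro (h1 | ⟨h1, -⟩ | ⟨-, hny⟩)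
        · exact absurd h1 (by decide)
        · exact absurd h1 (by decide)
        · exact hyz.resolve_left hny
  ext g
  rw [mem_iff S hS g, mem_iff T hT g, h]

/-- **The shear moves every splitting** of the Klein pair: `Γ(S) ≠ S` for `Γ : (a,b) ↦ (a+b,b)` — if `Γ` fixed
`S ∋ (a,1)` then `(a,1)⁻¹·Γ(a,1) = (1,0) ∈ S ∩ I`. [cite: MochizukiGalSect2005, §4 p.33] -/
theorem klein_map_ne_self
    (hI : ∀ g : Multiplicative (ZMod 2 × ZMod 2), g ∈ P.I ↔ (Multiplicative.toAdd g).2 = 0)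
    (hD : P.D = ⊤)
    {Γ : Multiplicative (ZMod 2 × ZMod 2) ≃ₜ* Multiplicative (ZMod 2 × ZMod 2)}
    (hΓ : ∀ g : Multiplicative (ZMod 2 × ZMod 2), Γ g =
      Multiplicative.ofAdd ((Multiplicative.toAdd g).1 + (Multiplicative.toAdd g).2, (Multiplicative.toAdd g).2))
    {S : Subgroup (Multiplicative (ZMod 2 × ZMod 2))} (hS : S ∈ P.splittings) :
    S.map Γ.toMulEquiv.toMonoidHom ≠ S := by
  intro hfix
  obtain ⟨s, hs, h1⟩ := klein_exists_mem_snd_eq_one hI hD hS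
  have hΓs : Γ s ∈ S := by
    rw [← hfix]; exact ⟨s, hs, rfl⟩
  have hx : s⁻¹ * Γ s ∈ S := S.mul_mem (S.inv_mem hs) hΓs
  -- `s⁻¹ · Γ s = (1, 0)`
  have key : ∀ v : ZMod 2 × ZMod 2, v.2 = 1 → -v + (v.1 + v.2, v.2) = (1, 0) := by decide
  have heq : s⁻¹ * Γ s = Multiplicative.ofAdd ((1 : ZMod 2), (0 : ZMod 2)) := by
    rw [hΓ s, klein_eq_ofAdd s]
    change Multiplicative.ofAdd (-(Multiplicative.toAdd s) +
      ((Multiplicative.toAdd s).1 + (Multiplicative.toAdd s).2, (Multiplicative.toAdd s).2)) = _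
    rw [key _ h1]
  rw [heq] at hx
  exact klein_x_not_mem hI hS hx

end Lemmas

/-! ### The certificate -/

/-- **KERNEL CERTIFICATE: equivariance of `μ`-sub-structures is not automatic.**  At the Klein pair
`(⊤, ⟨(1,0)⟩)` in `Multiplicative (ZMod 2 × ZMod 2)`: exactly two splitting classes; a genuine `ℤ/2`-torsor
structure `𝒯`; canonical structure `Rcan := univ`, a `⊤`-structure; the shear `Γ` satisfies `P.map Γ = P`; every
class transport `e` along `Γ` preserves `Rcan`; and NO `⊥`-sub-structure `R ⊆ Rcan` has `e '' R = R`.  So the v2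
laws of ROW (B)'s torsor data (structure + `μ ≤ O_K^×` + compatibility) together with pair preservation do NOT
yield the equivariance asked by the typed [EtTh] Cor. 2.8 (ii) — it is the named input (Thm. 1.10 (iii) /
[GalSect] Cor. 4.12). [cite: MochizukiEtTh2009, Cor 2.8 (ii) p.42] -/
theorem exists_klein_noInvariantSubStructure :
    ∃ (P : CuspPair (Multiplicative (ZMod 2 × ZMod 2)))
      (Γ : Multiplicative (ZMod 2 × ZMod 2) ≃ₜ* Multiplicative (ZMod 2 × ZMod 2))
      (𝒯 : P.TorsorData (Multiplicative (ZMod 2))) (Rcan : Set P.SplittingClass),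
      Nonempty (P.SplittingClass ≃ Multiplicative (ZMod 2)) ∧
      P.map Γ = P ∧ 𝒯.IsStructure ⊤ Rcan ∧
      (∀ e : P.SplittingClass → P.SplittingClass,
        (∀ (S : Subgroup (Multiplicative (ZMod 2 × ZMod 2))) (hS : S ∈ P.splittings),
          ∃ h', e (SplittingClass.mk P S hS) =
            SplittingClass.mk P (S.map Γ.toMulEquiv.toMonoidHom) h') →
        e '' Rcan = Rcan ∧
        ∀ R : Set P.SplittingClass, 𝒯.IsSubStructure ⊥ Rcan R → e '' R ≠ R) := by
  classical
  -- the inertia group `I = ⟨(1,0)⟩ = Ker(pr₂)`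
  let I : Subgroup (Multiplicative (ZMod 2 × ZMod 2)) :=
    (AddMonoidHom.toMultiplicative (AddMonoidHom.snd (ZMod 2) (ZMod 2))).ker
  have hImem : ∀ g : Multiplicative (ZMod 2 × ZMod 2), g ∈ I ↔ (Multiplicative.toAdd g).2 = 0 := by
    intro g
    simp only [I, MonoidHom.mem_ker, AddMonoidHom.toMultiplicative_apply_apply, AddMonoidHom.coe_snd,
      ofAdd_eq_one]
  -- the cuspidal pair `(⊤, I)`
  let P : CuspPair (Multiplicative (ZMod 2 × ZMod 2)) :=
    { D := ⊤, I := I, I_le := le_top, conj_I := fun d _ => klein_conj_smul d I }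
  have hI : ∀ g : Multiplicative (ZMod 2 × ZMod 2), g ∈ P.I ↔ (Multiplicative.toAdd g).2 = 0 := hImem
  have hD : P.D = ⊤ := rfl
  -- the shear
  let shearAdd : ZMod 2 × ZMod 2 ≃+ ZMod 2 × ZMod 2 :=
    { toFun := fun v => (v.1 + v.2, v.2)
      invFun := fun v => (v.1 + v.2, v.2)
      left_inv := fun v => by revert v; decide
      right_inv := fun v => by revert v; decide
      map_add' := fun v w => by revert v w; decide }
  let Γ : Multiplicative (ZMod 2 × ZMod 2) ≃ₜ* Multiplicative (ZMod 2 × ZMod 2) :=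
    { AddEquiv.toMultiplicative shearAdd with
      continuous_toFun := continuous_of_discreteTopology
      continuous_invFun := continuous_of_discreteTopology }
  have hΓ : ∀ g : Multiplicative (ZMod 2 × ZMod 2), Γ g =
      Multiplicative.ofAdd ((Multiplicative.toAdd g).1 + (Multiplicative.toAdd g).2,
        (Multiplicative.toAdd g).2) := fun g => rfl
  -- `Γ` preserves the pair
  have hpair : P.map Γ = P := by
    refine CuspPair.ext' ?_ ?_
    · change (⊤ : Subgroup (Multiplicative (ZMod 2 × ZMod 2))).map Γ.toMulEquiv.toMonoidHom = ⊤
      exact Subgroup.map_top_of_surjective _ Γ.surjective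
    · change I.map Γ.toMulEquiv.toMonoidHom = I
      ext g
      constructor
      · rintro ⟨i, hi, rfl⟩
        have hi' : (Multiplicative.toAdd i).2 = 0 := (hImem i).mp hi
        show Γ i ∈ I
        rw [hImem, hΓ]; simpa using hi'
      · intro hg
        refine ⟨g, hg, ?_⟩
        have h2 : (Multiplicative.toAdd g).2 = 0 := (hImem g).mp hg
        change Γ g = g
        rw [hΓ, h2, add_zero]
        conv_rhs => rw [klein_eq_ofAdd g, h2]
  -- the two splittings `S₁ = ⟨(0,1)⟩`, `S₂ = ⟨(1,1)⟩`
  let S₁ : Subgroup (Multiplicative (ZMod 2 × ZMod 2)) :=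
    (AddMonoidHom.toMultiplicative (AddMonoidHom.fst (ZMod 2) (ZMod 2))).ker
  have hS₁mem : ∀ g : Multiplicative (ZMod 2 × ZMod 2), g ∈ S₁ ↔ (Multiplicative.toAdd g).1 = 0 := by
    intro g
    simp only [S₁, MonoidHom.mem_ker, AddMonoidHom.toMultiplicative_apply_apply, AddMonoidHom.coe_fst,
      ofAdd_eq_one]
  let S₂ : Subgroup (Multiplicative (ZMod 2 × ZMod 2)) :=
    (AddMonoidHom.toMultiplicative (AddMonoidHom.fst (ZMod 2) (ZMod 2) + AddMonoidHom.snd (ZMod 2) (ZMod 2))).ker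
  have hS₂mem : ∀ g : Multiplicative (ZMod 2 × ZMod 2), g ∈ S₂ ↔
      (Multiplicative.toAdd g).1 + (Multiplicative.toAdd g).2 = 0 := by
    intro g
    simp only [S₂, MonoidHom.mem_ker, AddMonoidHom.toMultiplicative_apply_apply, AddMonoidHom.add_apply,
      AddMonoidHom.coe_fst, AddMonoidHom.coe_snd, ofAdd_eq_one]
  have hS₁ : S₁ ∈ P.splittings := by
    refine ⟨isClosed_discrete _, le_top, ?_, ?_⟩
    · refine eq_bot_iff.mpr fun g hg => ?_
      obtain ⟨h1, h2⟩ := Subgroup.mem_inf.mp hg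
      rw [hS₁mem] at h1; rw [hI] at h2
      rw [Subgroup.mem_bot, klein_eq_ofAdd g, h1, h2]; rfl
    · refine eq_top_iff.mpr fun g _ => ?_
      have hsplit : ∀ a b : ZMod 2, (a, b) = (0, b) + (a, 0) := by decide
      rw [klein_eq_ofAdd g, hsplit, ofAdd_add]
      exact Subgroup.mul_mem_sup ((hS₁mem _).mpr rfl) ((hI _).mpr rfl)
  have hS₂ : S₂ ∈ P.splittings := by
    refine ⟨isClosed_discrete _, le_top, ?_, ?_⟩
    · refine eq_bot_iff.mpr fun g hg => ?_
      obtain ⟨h1, h2⟩ := Subgroup.mem_inf.mp hg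
      rw [hS₂mem] at h1; rw [hI] at h2
      rw [h2, add_zero] at h1
      rw [Subgroup.mem_bot, klein_eq_ofAdd g, h1, h2]; rfl
    · refine eq_top_iff.mpr fun g _ => ?_
      have hsplit : ∀ a b : ZMod 2, (a, b) = (b, b) + (a + b, 0) := by decide
      rw [klein_eq_ofAdd g, hsplit, ofAdd_add]
      refine Subgroup.mul_mem_sup ((hS₂mem _).mpr ?_) ((hI _).mpr rfl)
      change (Multiplicative.toAdd g).2 + (Multiplicative.toAdd g).2 = 0
      have : ∀ b : ZMod 2, b + b = 0 := by decide
      exact this _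
  have hyS₁ : Multiplicative.ofAdd ((0 : ZMod 2), (1 : ZMod 2)) ∈ S₁ := (hS₁mem _).mpr rfl
  have hyS₂ : Multiplicative.ofAdd ((0 : ZMod 2), (1 : ZMod 2)) ∉ S₂ := fun h => by
    rw [hS₂mem] at h; exact absurd h (by decide)
  -- exactly two classes: `[S] ↦ (is (0,1) ∈ S ?)`
  let f : P.SplittingClass → Multiplicative (ZMod 2) :=
    Quotient.lift (fun S : P.splittings =>
        if Multiplicative.ofAdd ((0 : ZMod 2), (1 : ZMod 2)) ∈ S.1 then 1 else Multiplicative.ofAdd 1)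
      (fun S T hST => by
        obtain ⟨i, -, hT⟩ := hST
        rw [klein_conj_smul] at hT
        simp only [hT])
  have hf : ∀ (S : Subgroup (Multiplicative (ZMod 2 × ZMod 2))) (hS : S ∈ P.splittings),
      f (SplittingClass.mk P S hS) =
        if Multiplicative.ofAdd ((0 : ZMod 2), (1 : ZMod 2)) ∈ S then 1 else Multiplicative.ofAdd 1 :=
    fun S hS => rfl
  have hone : (Multiplicative.ofAdd (1 : ZMod 2)) ≠ 1 := by decide
  have hfinj : Function.Injective f := by
    intro c c' hcc'
    obtain ⟨S, hS, rfl⟩ := SplittingClass.exists_rep P c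
    obtain ⟨T, hT, rfl⟩ := SplittingClass.exists_rep P c'
    rw [hf S hS, hf T hT] at hcc'
    have hiff : Multiplicative.ofAdd ((0 : ZMod 2), (1 : ZMod 2)) ∈ S ↔
        Multiplicative.ofAdd ((0 : ZMod 2), (1 : ZMod 2)) ∈ T := by
      by_cases hyS : Multiplicative.ofAdd ((0 : ZMod 2), (1 : ZMod 2)) ∈ S <;>
        by_cases hyT : Multiplicative.ofAdd ((0 : ZMod 2), (1 : ZMod 2)) ∈ T <;>
        simp only [hyS, hyT, if_true, if_false] at hcc' ⊢ <;> first | rfl | exact absurd hcc' hone |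
          exact absurd hcc'.symm hone
    have hST : S = T := klein_splitting_eq_of_iff hI hD hS hT hiff
    subst hST; rfl
  have hfsurj : Function.Surjective f := by
    intro a
    have ha : ∀ a : Multiplicative (ZMod 2), a = 1 ∨ a = Multiplicative.ofAdd 1 := by decide
    rcases ha a with rfl | rfl
    · exact ⟨SplittingClass.mk P S₁ hS₁, by rw [hf S₁ hS₁, if_pos hyS₁]⟩
    · exact ⟨SplittingClass.mk P S₂ hS₂, by rw [hf S₂ hS₂, if_neg hyS₂]⟩
  let eqv : P.SplittingClass ≃ Multiplicative (ZMod 2) := Equiv.ofBijective f ⟨hfinj, hfsurj⟩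
  -- a genuine `ℤ/2`-torsor structure; canonical structure := the whole torsor (the `⊤`-orbit)
  let 𝒯 : P.TorsorData (Multiplicative (ZMod 2)) := TorsorData.ofEquiv eqv
  refine ⟨P, Γ, 𝒯, Set.univ, ⟨eqv⟩, hpair, ?_, fun e he => ⟨?_, ?_⟩⟩
  · -- `univ` is the `⊤`-orbit of any class
    refine ⟨SplittingClass.mk P S₁ hS₁, Set.mem_univ _, ?_⟩
    ext c'
    simp only [Set.mem_univ, Set.mem_setOf_eq, true_iff]
    obtain ⟨a, ha⟩ := TorsorData.exists_act_eq 𝒯 (SplittingClass.mk P S₁ hS₁) c'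
    exact ⟨a, Subgroup.mem_top a, ha.symm⟩
  · -- the canonical structure is preserved by the class transport
    exact Set.image_univ_of_surjective (classTransport_surjective hpair he)
  · -- but NO `μ`-sub-structure (`μ = ⊥`: a single class) is
    rintro R ⟨⟨c, hc, hR⟩, -⟩ hfix
    have hRc : R = {c} := by
      rw [hR]; ext c'
      simp only [Subgroup.mem_bot, exists_eq_left, Set.mem_setOf_eq, Set.mem_singleton_iff, 𝒯.act_one]
    rw [hRc, Set.image_singleton, Set.singleton_eq_singleton_iff] at hfix
    obtain ⟨S, hS, rfl⟩ := SplittingClass.exists_rep P c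
    obtain ⟨h', heS⟩ := he S hS
    rw [heS, SplittingClass.mk_eq_mk_iff] at hfix
    obtain ⟨i, -, hSi⟩ := hfix
    rw [klein_conj_smul] at hSi
    exact klein_map_ne_self hI hD hΓ hS hSi.symm

/-- **The same certificate in the census' "weakly equivariant family" shape** (`GalSectCor28iiNodeCensus`,
`cor28iiAt_iff_weakEquivariantFamily`, one cusp, image cusp = itself): at the Klein pair with its shear there is
NO `μ`-sub-structure of the canonical structure that the class transports along `Γ` carry onto itself — although
such sub-structures EXIST (`TorsorData.exists_isSubStructure`) and the canonical structure itself is carried onto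
itself.  Hence the equivariance half of the node closer's named input is substantive. [cite: MochizukiEtTh2009, Cor 2.8 (ii) p.42] -/
theorem exists_klein_not_weaklyEquivariantFamily :
    ∃ (P : CuspPair (Multiplicative (ZMod 2 × ZMod 2)))
      (Γ : Multiplicative (ZMod 2 × ZMod 2) ≃ₜ* Multiplicative (ZMod 2 × ZMod 2))
      (𝒯 : P.TorsorData (Multiplicative (ZMod 2))) (Rcan : Set P.SplittingClass),
      P.map Γ = P ∧ 𝒯.IsStructure ⊤ Rcan ∧ (∃ R, 𝒯.IsSubStructure ⊥ Rcan R) ∧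
      ¬ ∃ R : Set P.SplittingClass, 𝒯.IsSubStructure ⊥ Rcan R ∧
          ∀ e : P.SplittingClass → P.SplittingClass,
            (∀ (S : Subgroup (Multiplicative (ZMod 2 × ZMod 2))) (hS : S ∈ P.splittings),
              ∃ h', e (SplittingClass.mk P S hS) =
                SplittingClass.mk P (S.map Γ.toMulEquiv.toMonoidHom) h') →
            e '' R = R := by
  obtain ⟨P, Γ, 𝒯, Rcan, -, hpair, hcan, hmain⟩ := exists_klein_noInvariantSubStructure
  refine ⟨P, Γ, 𝒯, Rcan, hpair, hcan, 𝒯.exists_isSubStructure bot_le hcan, ?_⟩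
  rintro ⟨R, hR, hall⟩
  obtain ⟨e, he⟩ := exists_classTransport Γ hpair
  exact (hmain e he).2 R hR (hall e he)

end Literature.AnabelianGeometry.EtaleTheta.GalSect.CuspPair

end
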